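import Summits.QuantumFields.YangMills.Theorems.SwapVirialDeficitSectorLaplaceBTubeFibredUniform
import HarnessLib

/-!
# STUB (S-B) OF SKELETON ➎: THE B-TUBE √b LAW OVER AN ABSTRACT MEASURABLE REGION (δ-window, base set AND the axial cap of LEAD g99 20:48Z)
# (free-hands support of ⟨stmt-QuantumFields-24197⟩ `SwapVirialDeficit.SwapGluedStiffness` ∕ ⟨24194⟩; cell ym-idea-1, LEAD memo7 §E(3) + ruling 2026-08-31 20:48:54Z:
# «the B-tube needs an AXIAL CAP |X| ≤ X₁ in the rescaled letter x₀ = √(1+|u|²)·X; the far floor is false on ✓BTube, true on BTubeCap»)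

✓`bTube_fibred_scaled_cylinder_uniform` integrates over the window-cylinder `{δ ∈ W} ∩ {u ∈ S}`.  The cap `|X| ≤ X₁` is one more FIBRE-letter window
(`(Ψ′_B(u,y)).2.1.1 0 = √(1+|u|²)·y_{x₀}`, ✓`gnoFibreBEquiv_gnoScaleB`), so here the region is ABSTRACT: any measurable `Rg ⊆ ℝ × GnoCoord L` inside the cylinder over `S`
that contains the scaled tube `Ψ′_B(S × B̄_R)`, with the far floor `λ_B R² ≤ F_B` on `Rg` off the tube.
* `abs_axial_gnoScaleBChart` (`|(Ψ′_B(u,y)).2.1.1 0| = √(1+|u|²)·|y_{x₀}| ≤ √(1+|u|²)·‖y‖` — tube points satisfy the cap as soon as `R ≤ X₁`);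
* ★★★ `bTube_fibred_region_uniform (ε) (hz) (hε) (hτ) (hτ1)` — ∃ `A′` (symmetric; ray identity; `λ_B`-coercive and `λ_B^{m_B} ≤ det A′_u` on `{τ² ≤ |u|²}`) such that for
  EVERY measurable `S ⊆ {τ² ≤ |u|²}` with a point, EVERY measurable region `Rg` with `Ψ′_B(u,y) ∈ Rg` for `u ∈ S`, `‖y‖ ≤ R` and `Rg ⊆ {(η_x1, η_x2) ∈ S}`, radius
  `1136016L⁴R ≤ λ_B∕(8(m_B+8))`, `2R² ≤ 1`, `0 < b`, and the far floor `∀ u ∈ S, ∀ y, R ≤ ‖y‖ → Ψ′_B(u,y) ∈ Rg → λ_B R² ≤ F_B(Ψ′_B(u,y))`: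
  `|∫_{Rg} e^{−bF_B} dμ_B − (2π∕b)^{m_B∕2}∫_S w₀∕√det A′| ≤ (K₃∕√b + 16(m_B+8)∕(λ_B R²b))·(2π∕b)^{m_B∕2}∫_S w₀∕√det A′ + e^{−bλ_B R²}·μ_B(X)`.

HONEST LABEL: (S-B) is NOT closed (the far floor on BTubeCap — now a TRUE statement per LEAD, owner w3-successor ∕ LEAD; the log-law ∕ action step; the BTubeCap reading);
(S-core), (S-001), ⟨24197⟩ ∕ ⟨24194⟩ OPEN; own crux ⟨22884⟩ OPEN (blocked-on ⟨19935⟩); the Yang–Mills mass gap is NOT proved; no summit is proved by a line.  THEOREMS ONLY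
(0 `def`, 0 `sorry`), standard axioms.  Width seat ym-line-sfw-p2-w2 g59 (cell ym-idea-1, free hands), `--supports stmt-QuantumFields-24197`.
References: [cite: Luscher1983, §2]; [cite: HasenpflugRudolfSprungk2024, App. 4.1 Thm 16]; [folklore].
-/


set_option autoImplicit false
set_option synthInstance.maxSize 1024

noncomputable section

open MeasureTheory Quaternion Set Metric Module
open scoped Quaternion BigOperators ENNReal InnerProductSpace
open Literature.MathematicalPhysics.QuantumLattice
open Literature.MathematicalPhysics.QuantumFieldTheory hiding SU2

namespace Summit.QuantumFields.YangMills.Theorems.SwapVirialDeficit.BlowUpRing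

open Summit.QuantumFields.YangMills.Theorems.FemtoTransferGap
open Summit.QuantumFields.YangMills.Theorems.FemtoTransferGap.TT
open Summit.QuantumFields.YangMills.Theorems.VirialFluxGap.RingDeficit
open Summit.QuantumFields.YangMills.Theorems.SwapVirialDeficit.SwapRing
open Summit.QuantumFields.YangMills.Theorems.SwapVirialDeficit.Gnomonic (normSq3 normSq3_nonneg gnomonicWeight gnomonicWeight_pos)
open Summit.QuantumFields.YangMills.Theorems.QuantitativeLaplace (laplaceMethod_quantitative_fibred_chart_cubic_offBound_on offTube_bound_of_cylinder)

variable {L : ℕ} [NeZero L]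

/-- The axial `x`-letter of `Ψ′_B(u, y)` is `√(1+|u|²)·y_{x₀}`, of size `≤ √(1+|u|²)·‖y‖` — tube points of radius `R ≤ X₁` satisfy the axial cap `|η_x0| ≤ X₁√(1+|u|²)`. [folklore] -/
theorem abs_axial_gnoScaleBChart (u : ℝ × ℝ) (y : GnoFibreB L) :
    |(gnoFibreBEquiv (u, gnoScaleB u y)).2.1.1 0| = Real.sqrt (1 + (u.1 ^ 2 + u.2 ^ 2)) * |y (Sum.inl (Sum.inl 1))| ∧
      |(gnoFibreBEquiv (u, gnoScaleB u y)).2.1.1 0| ≤ Real.sqrt (1 + (u.1 ^ 2 + u.2 ^ 2)) * ‖y‖ := by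
  have e : (gnoFibreBEquiv (u, gnoScaleB u y)).2.1.1 0 = Real.sqrt (1 + (u.1 ^ 2 + u.2 ^ 2)) * y (Sum.inl (Sum.inl 1)) := by
    rw [gnoFibreBEquiv_gnoScaleB]; simp
  have hc0 : 0 ≤ Real.sqrt (1 + (u.1 ^ 2 + u.2 ^ 2)) := Real.sqrt_nonneg _
  have h1 : y (Sum.inl (Sum.inl 1)) ^ 2 ≤ ‖y‖ ^ 2 := by
    rw [norm_sq_gnoFibreB_letters]
    nlinarith [sq_nonneg (y (Sum.inl (Sum.inl 0))), sq_nonneg (y (Sum.inl (Sum.inl 2))), sq_nonneg (y (Sum.inl (Sum.inr 0))), sq_nonneg (y (Sum.inl (Sum.inr 1))),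
      normSq3_nonneg (fun k => y (Sum.inr (Sum.inl k))), Finset.sum_nonneg fun f (_ : f ∈ Finset.univ) => normSq3_nonneg (fun k => y (Sum.inr (Sum.inr (f, k))))]
  have h2 : |y (Sum.inl (Sum.inl 1))| ≤ ‖y‖ := abs_le_of_sq_le_sq' h1 (norm_nonneg y) |> fun h => abs_le.2 h
  rw [e, abs_mul, abs_of_nonneg hc0]
  exact ⟨rfl, mul_le_mul_of_nonneg_left h2 hc0⟩

/-- ★★★ **THE FIBRED √b LAW OF THE STRATUM-B TUBES OVER AN ABSTRACT REGION** (principal signs; `0 < τ ≤ 1`; `λ_B = τ²∕((1+τ²)·12375·L¹⁰)`; `A₃ = 1136016L⁴`):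
for every measurable base set `S ⊆ {τ² ≤ |u|²}` with a point and every measurable region `Rg` containing the scaled tube over `S` and contained in the cylinder over `S`,
radius `1136016L⁴·R ≤ λ_B∕(8(m_B+8))`, `2R·R ≤ 1`, `0 < b`, and the FAR FLOOR on `Rg` off the tube:
`|∫_{Rg} e^{−bF_B} dμ_B − Main| ≤ (K₃∕√b + 16(m_B+8)∕(λ_B R²b))·Main + e^{−bλ_B R²}·μ_B(X)`, `Main = (2π∕b)^{m_B∕2}∫_S w₀∕√det A′`.
[cite: Luscher1983, §2] [cite: HasenpflugRudolfSprungk2024, App. 4.1 Thm 16] -/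
theorem bTube_fibred_region_uniform (ε : GnoSign L) (hz : ε.2.1 = true) (hε : ε.2.2 = fun _ => true) {τ : ℝ} (hτ : 0 < τ) (hτ1 : τ ≤ 1) :
    ∃ A' : ℝ × ℝ → GnoFibreB L →ₗ[ℝ] GnoFibreB L,
      (∀ u, (A' u).IsSymmetric) ∧
      (∀ u (y : GnoFibreB L), ⟪A' u y, y⟫_ℝ =
        iteratedDeriv 2 (fun s : ℝ => gnoDeficit (fun _ => false) (fun _ => 1) (hubAt (gnoBaseB u + s • gnoFibreBEmb (gnoScaleB u y)).1 1) ε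
          (gnoBaseB u + s • gnoFibreBEmb (gnoScaleB u y)).2) 0) ∧
      (∀ u : ℝ × ℝ, τ ^ 2 ≤ u.1 ^ 2 + u.2 ^ 2 → ∀ y : GnoFibreB L, τ ^ 2 / ((1 + τ ^ 2) * (12375 * (L : ℝ) ^ 10)) * ‖y‖ ^ 2 ≤ ⟪A' u y, y⟫_ℝ) ∧
      (∀ u : ℝ × ℝ, τ ^ 2 ≤ u.1 ^ 2 + u.2 ^ 2 → (τ ^ 2 / ((1 + τ ^ 2) * (12375 * (L : ℝ) ^ 10))) ^ finrank ℝ (GnoFibreB L) ≤ LinearMap.det (A' u)) ∧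
      ∀ {S : Set (ℝ × ℝ)}, MeasurableSet S → S ⊆ {u : ℝ × ℝ | τ ^ 2 ≤ u.1 ^ 2 + u.2 ^ 2} → ∀ {p₀ : ℝ × ℝ}, p₀ ∈ S →
      ∀ {Rg : Set (ℝ × GnoCoord L)}, MeasurableSet Rg → ∀ {R b : ℝ}, 0 < R → 0 < b →
        (∀ u ∈ S, ∀ y : GnoFibreB L, ‖y‖ ≤ R → gnoFibreBEquiv (u, gnoScaleB u y) ∈ Rg) → Rg ⊆ {p : ℝ × GnoCoord L | (p.2.1.1 1, p.2.1.1 2) ∈ S} →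
        1136016 * (L : ℝ) ^ 4 * R ≤ τ ^ 2 / ((1 + τ ^ 2) * (12375 * (L : ℝ) ^ 10)) / (8 * ((finrank ℝ (GnoFibreB L) : ℝ) + 8)) → 2 * R * R ≤ 1 →
        (∀ u ∈ S, ∀ y : GnoFibreB L, R ≤ ‖y‖ → gnoFibreBEquiv (u, gnoScaleB u y) ∈ Rg →
          τ ^ 2 / ((1 + τ ^ 2) * (12375 * (L : ℝ) ^ 10)) * R ^ 2 ≤
            gnoDeficit (fun _ => false) (fun _ => 1) (hubAt (gnoFibreBEquiv (u, gnoScaleB u y)).1 1) ε (gnoFibreBEquiv (u, gnoScaleB u y)).2) →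
        |(∫ p in Rg,
              Real.exp (-(b * gnoDeficit (fun _ => false) (fun _ => 1) (hubAt p.1 1) ε p.2))
              ∂((volume : Measure (ℝ × GnoCoord L)).withDensity fun p => ENNReal.ofReal (((1 + p.1 ^ 2)⁻¹) ^ 2 * gnoDensity p.2))) -
            (2 * Real.pi / b) ^ ((finrank ℝ (GnoFibreB L) : ℝ) / 2) *
              ∫ u in S, gnomonicWeight (![0, u.1, u.2] : Fin 3 → ℝ) * Real.sqrt (1 + (u.1 ^ 2 + u.2 ^ 2)) / Real.sqrt (LinearMap.det (A' u))| ≤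
          ((16 * (1136016 * (L : ℝ) ^ 4) * ((finrank ℝ (GnoFibreB L) : ℝ) + 8) / (τ ^ 2 / ((1 + τ ^ 2) * (12375 * (L : ℝ) ^ 10))) +
                  256 * (1136016 * (L : ℝ) ^ 4) * ((finrank ℝ (GnoFibreB L) : ℝ) + 8) ^ 2 / (τ ^ 2 / ((1 + τ ^ 2) * (12375 * (L : ℝ) ^ 10))) ^ 2 + 2 * R +
                  8 * (2 * R) * ((finrank ℝ (GnoFibreB L) : ℝ) + 8) / (τ ^ 2 / ((1 + τ ^ 2) * (12375 * (L : ℝ) ^ 10)))) / Real.sqrt b +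
              16 * ((finrank ℝ (GnoFibreB L) : ℝ) + 8) / (τ ^ 2 / ((1 + τ ^ 2) * (12375 * (L : ℝ) ^ 10)) * R ^ 2) / b) *
            ((2 * Real.pi / b) ^ ((finrank ℝ (GnoFibreB L) : ℝ) / 2) *
              ∫ u in S, gnomonicWeight (![0, u.1, u.2] : Fin 3 → ℝ) * Real.sqrt (1 + (u.1 ^ 2 + u.2 ^ 2)) / Real.sqrt (LinearMap.det (A' u))) +
          Real.exp (-(b * (τ ^ 2 / ((1 + τ ^ 2) * (12375 * (L : ℝ) ^ 10)) * R ^ 2))) *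
            ((volume : Measure (ℝ × GnoCoord L)).withDensity fun p => ENNReal.ofReal (((1 + p.1 ^ 2)⁻¹) ^ 2 * gnoDensity p.2)).real univ := by
  obtain ⟨A, ρ, e, hAs, hAm, hρm, hem, hray, hcoer, hf, -, hw, heb⟩ := bFibre_rescaled_sockets (L := L) ε hz hε hτ hτ1
  have hL : (0 : ℝ) < (L : ℝ) := by exact_mod_cast NeZero.pos L
  set lam : ℝ := τ ^ 2 / ((1 + τ ^ 2) * (12375 * (L : ℝ) ^ 10)) with hlam
  have hlam0 : 0 < lam := by positivity
  have hdet : ∀ u : ℝ × ℝ, τ ^ 2 ≤ u.1 ^ 2 + u.2 ^ 2 → lam ^ finrank ℝ (GnoFibreB L) ≤ LinearMap.det (A u) := fun u hu =>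
    det_ge_pow_of_coercive (hAs u) hlam0 (hcoer u hu)
  refine ⟨A, hAs, hray, hcoer, hdet, ?_⟩
  intro S hS hSτ p₀ hp₀ Rg hRgm R b hR hb htube hcyl hsmall hDR hfar
  have hA₃ : (0 : ℝ) ≤ 1136016 * (L : ℝ) ^ 4 := by positivity
  -- the measure space and the letters
  set μB : Measure (ℝ × GnoCoord L) := (volume : Measure (ℝ × GnoCoord L)).withDensity fun p => ENNReal.ofReal (((1 + p.1 ^ 2)⁻¹) ^ 2 * gnoDensity p.2) with hμB
  haveI : IsFiniteMeasure μB := isFiniteMeasure_muB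
  set f : ℝ × GnoCoord L → ℝ := fun p => gnoDeficit (fun _ => false) (fun _ => 1) (hubAt p.1 1) ε p.2 with hfdef
  have hfm : Measurable f := measurable_bDeficit _ _ ε
  set φ : ℝ × GnoCoord L → ℝ := Rg.indicator (fun _ => (1 : ℝ)) with hφ
  have hφm : Measurable φ := measurable_const.indicator hRgm
  set Ψ' : (ℝ × ℝ) × GnoFibreB L → ℝ × GnoCoord L := fun q => gnoFibreBEquiv (q.1, gnoScaleB q.1 q.2) with hΨ'
  obtain ⟨hTm, hchart⟩ := volume_muB_restrict_scaledBTube_eq_map (L := L) hS R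
  have hΨm : Measurable Ψ' := measurable_gnoScaleBChart (L := L)
  have hJm : Measurable fun q : (ℝ × ℝ) × GnoFibreB L =>
      (∏ i, |gnoFibreBScale (L := L) q.1 i|) * (((1 + (gnoFibreBEquiv (q.1, gnoScaleB q.1 q.2)).1 ^ 2)⁻¹) ^ 2 * gnoDensity (gnoFibreBEquiv (q.1, gnoScaleB q.1 q.2)).2) :=
    (Finset.measurable_prod _ fun i _ => ((measurable_gnoFibreBScale i).comp measurable_fst).abs).mul (measurable_bDensity.comp (measurable_gnoScaleBChart (L := L)))
  have hJ0 : ∀ q ∈ S ×ˢ closedBall (0 : GnoFibreB L) R,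
      0 ≤ (∏ i, |gnoFibreBScale (L := L) q.1 i|) * (((1 + (gnoFibreBEquiv (q.1, gnoScaleB q.1 q.2)).1 ^ 2)⁻¹) ^ 2 * gnoDensity (gnoFibreBEquiv (q.1, gnoScaleB q.1 q.2)).2) :=
    fun q _ => mul_nonneg (Finset.prod_nonneg fun i _ => abs_nonneg _) (bDensity_pos _).le
  obtain ⟨hw0pos, hw0m, hw0i⟩ := bBaseWeight_facts
  -- coercivity and the cubic constant on `S`
  have hcoerS : ∀ u ∈ S, ∀ y : GnoFibreB L, lam * ‖y‖ ^ 2 ≤ ⟪A u y, y⟫_ℝ := fun u hu y => hcoer u (hSτ hu) y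
  have hρS : ∀ u ∈ S, ∀ y : GnoFibreB L, ‖y‖ ≤ R → |ρ (u, y)| ≤ 1136016 * (L : ℝ) ^ 4 * ‖y‖ ^ 3 := by
    intro u _ y _
    have eρ : ρ (u, y) = gnoDeficit (fun _ => false) (fun _ => 1) (hubAt (gnoFibreBEquiv (u, gnoScaleB u y)).1 1) ε (gnoFibreBEquiv (u, gnoScaleB u y)).2 -
        (1 / 2) * ⟪A u y, y⟫_ℝ := by linarith [hf u y]
    rw [eρ, hray]
    exact bFibre_rescaled_cubic ε hz hε u y
  -- membership of tube points in the region
  have hmemRg : ∀ u ∈ S, ∀ y : GnoFibreB L, ‖y‖ ≤ R → Ψ' (u, y) ∈ Rg := fun u hu y hy => htube u hu y hy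
  -- `hw` with the cut-off `φ`
  have hw' : ∀ u ∈ S, ∀ y : GnoFibreB L, ‖y‖ ≤ R →
      (∏ i, |gnoFibreBScale (L := L) u i|) * (((1 + (gnoFibreBEquiv (u, gnoScaleB u y)).1 ^ 2)⁻¹) ^ 2 * gnoDensity (gnoFibreBEquiv (u, gnoScaleB u y)).2) *
          φ (Ψ' (u, y)) = gnomonicWeight (![0, u.1, u.2] : Fin 3 → ℝ) * Real.sqrt (1 + (u.1 ^ 2 + u.2 ^ 2)) * (1 + e (u, y)) := by
    intro u hu y hy
    rw [hφ, indicator_of_mem (hmemRg u hu y hy), ← hw u y]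
  -- the off-tube bound
  have hoff : ∀ x, x ∉ Ψ' '' (S ×ˢ closedBall (0 : GnoFibreB L) R) → ‖Real.exp (-(b * (f x - 0))) * φ x‖ ≤ 1 * Real.exp (-(b * (lam * R ^ 2))) := by
    refine offTube_bound_of_cylinder (C := Rg) hb.le (fun x hx => by rw [hφ, indicator_of_notMem hx]) zero_le_one
      (fun x hx => by rw [hφ, indicator_of_mem hx, abs_one]) fun x hx hxT => ?_
    have hcyl' : x ∈ Ψ' '' (S ×ˢ (univ : Set (GnoFibreB L))) := by
      rw [hΨ', gnoScaleBChart_image_prod_univ]; exact hcyl hx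
    obtain ⟨u, hu, y, hRy, rfl⟩ := exists_of_mem_cylinderB_not_mem_scaledTube hcyl' hxT
    rw [zero_add, hfdef]
    exact hfar u hu y hRy.le hx
  -- apply the generic law
  obtain ⟨-, hbd⟩ := laplaceMethod_quantitative_fibred_chart_cubic_offBound_on (X := ℝ × GnoCoord L) (μ := μB) (M := ℝ × ℝ) (ν := volume) (V := GnoFibreB L)
    (Ψ := Ψ') (J := fun q => (∏ i, |gnoFibreBScale (L := L) q.1 i|) *
      (((1 + (gnoFibreBEquiv (q.1, gnoScaleB q.1 q.2)).1 ^ 2)⁻¹) ^ 2 * gnoDensity (gnoFibreBEquiv (q.1, gnoScaleB q.1 q.2)).2)) (f := f) (φ := φ) (f₀ := 0)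
    hS hp₀ (A := A) (fun u _ => hAs u) hlam0 hcoerS hAm (R := R) (A₃ := 1136016 * (L : ℝ) ^ 4) (D := 2 * R) (β := b) (Eoff := 1 * Real.exp (-(b * (lam * R ^ 2))))
    hR hA₃ (by positivity) hb hsmall hDR hΨm hTm hJm hJ0 hchart hfm hφm hρm hem hw0m (fun u _ => (hw0pos u).le) hw0i.integrableOn
    hρS (fun u _ y hy => heb R hR.le u y hy) (fun u _ y _ => hf u y) hw' (by positivity) (Filter.Eventually.of_forall hoff)
  -- read back: the cut-off integral is the set integral over the window-cylinder
  rw [one_mul] at hbd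
  have hlhs : ∫ x, Real.exp (-(b * (f x - 0))) * φ x ∂μB = ∫ p in Rg, Real.exp (-(b * f p)) ∂μB := by
    rw [← integral_indicator hRgm]
    refine integral_congr_ae (Filter.Eventually.of_forall fun x => ?_)
    show Real.exp (-(b * (f x - 0))) * φ x = Rg.indicator (fun p => Real.exp (-(b * f p))) x
    by_cases hx : x ∈ Rg
    · rw [hφ, indicator_of_mem hx, indicator_of_mem hx, sub_zero, mul_one]
    · rw [hφ, indicator_of_notMem hx, indicator_of_notMem hx, mul_zero]
  rw [hlhs] at hbd
  exact hbd

end Summit.QuantumFields.YangMills.Theorems.SwapVirialDeficit.BlowUpRing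

end
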